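import Summits.CriticalPhenomena.PercolationContinuityZ3.Theorems.PercNearOneGluingNoHeavyLowerTailSunflowerGradedTBernScheme
import Summits.CriticalPhenomena.PercolationContinuityZ3.Theorems.PercNearOneGluingNoHeavyLowerTailSunflowerTBernMergeT
import HarnessLib

/-!
# `NoHeavyLowerTail` (crux stmt-CriticalPhenomena-4575), abstract sunflower cubic: GRADED T-BERN — the two merges
# (h + h, h + leveraged tight petal) in the presence of the phantom block

Support file (seat `prim-ineq-prove-1` gen 69; `--supports stmt-CriticalPhenomena-4575`).  No `sorry`, no named facts, no
definitions.  Memo: run/shared/lean/prim/prim-ineq-prove-1/FINDING-GRADED-prove1-g69.md §4.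

The merges R3 (two h-petals) and R4 (h-petal into a leveraged tight petal) of `…SunflowerTBernMerge` / `…SunflowerTBernMergeT`
replace two petals by {floor, merged petal} with the block product kept EXACTLY (`a₀·g′ = g_i·g_j`); hence the tightened block
budget `(∏g)·x ≤ a₀^|t|` passes to the merged family on `t.erase j` with the same phantom `x` (`admissibleG_merge_h`,
`admissibleG_merge_hT`, from the `V = 1` admissibility lemmas), and the polynomial step `ℓ_iℓ_j ≤_coef (A₀X+a₀)ℓ′`
transfers the certificate with the phantom factor carried along (`domG_of_merge_pair`, `domG_of_merge_h`, `domG_of_merge_hT`).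
-/

noncomputable section

namespace Summit.CriticalPhenomena.PercolationContinuityZ3.Theorems.SunflowerPartition

namespace SafeCalc

namespace LinkedCurrency

open Finset Polynomial

variable {ι : Type*}

/-! ## The transfer lemma for a pair merge (graded) -/

/-- **Pair-merge transfer (graded).**  If the two petals `j, i ∈ t` satisfy `ℓ_j·ℓ_i ≤_coef (A₀X+a₀)·ℓ_i'` where `ℓ_i'` is the
petal `i` with `vv_i` replaced by `vv'_i` (and `vv' = vv` elsewhere on `t`), then `DomG` for the merged family on `t.erase j`
gives `DomG` for the original family on `t` (same phantom `x ≥ 0`). [this work] -/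
theorem domG_of_merge_pair [DecidableEq ι] {s b β x : ℝ} (hs0 : 0 ≤ s) (hs1 : s ≤ 1) (hb : 0 ≤ b) (hβ : 0 ≤ β) (hx : 0 ≤ x)
    {t : Finset ι} {u vv m vv' : ι → ℝ} {i j : ι} (hij : i ≠ j) (hi : i ∈ t) (hj : j ∈ t)
    (hu0 : ∀ k ∈ t, 0 ≤ u k) (hm0 : ∀ k ∈ t, 0 ≤ m k) (hv0 : ∀ k ∈ t, 0 ≤ vv k)
    (hvv' : ∀ k ∈ t, k ≠ i → vv' k = vv k)
    (hstep : CoefDom ((C (s + (1 - s) * u j) * X + C ((1 - s) * m j + s * vv j)) *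
        (C (s + (1 - s) * u i) * X + C ((1 - s) * m i + s * vv i)))
      ((C (s + (1 - s) * b) * X + C ((1 - s) * b + s * β)) * (C (s + (1 - s) * u i) * X + C ((1 - s) * m i + s * vv' i))))
    (hdom : DomG s b β x (t.erase j) u vv' m) : DomG s b β x t u vv m := by
  have hs' : 0 ≤ 1 - s := sub_nonneg.2 hs1
  set a : ι → ℝ := fun k => s + (1 - s) * u k with had
  set c : ι → ℝ := fun k => (1 - s) * m k + s * vv k with hcd
  set c' : ι → ℝ := fun k => (1 - s) * m k + s * vv' k with hc'd
  set E : ℝ[X] := C 1 * X + C x with hEd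
  have hE : CoefNonneg E := coefNonneg_lin zero_le_one hx
  have hjt : j ∉ t.erase j := notMem_erase j t
  have hit' : i ∈ t.erase j := mem_erase.2 ⟨hij, hi⟩
  have hit'' : i ∉ (t.erase j).erase i := notMem_erase i _
  set R := prodPoly ((t.erase j).erase i) a c with hRd
  have hR : CoefNonneg R := coefNonneg_prodPoly _ (fun k hk => by
      have hk' := mem_of_mem_erase (mem_of_mem_erase hk)
      show 0 ≤ s + (1 - s) * u k
      exact add_nonneg hs0 (mul_nonneg hs' (hu0 k hk')))
    (fun k hk => by
      have hk' := mem_of_mem_erase (mem_of_mem_erase hk)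
      show 0 ≤ (1 - s) * m k + s * vv k
      exact add_nonneg (mul_nonneg hs' (hm0 k hk')) (mul_nonneg hs0 (hv0 k hk')))
  have hR' : prodPoly ((t.erase j).erase i) a c' = R := by
    refine prodPoly_congr (fun k _ => rfl) (fun k hk => ?_)
    have hk' : k ∈ t := mem_of_mem_erase (mem_of_mem_erase hk)
    have hki : k ≠ i := (mem_erase.1 hk).1
    show (1 - s) * m k + s * vv' k = (1 - s) * m k + s * vv k
    rw [hvv' k hk' hki]
  -- factorizations
  have e1 : prodPoly t a c = (C (a j) * X + C (c j)) * ((C (a i) * X + C (c i)) * R) := by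
    rw [hRd]
    conv_lhs => rw [← insert_erase hj, prodPoly_insert hjt, ← insert_erase hit', prodPoly_insert hit'']
  have e2 : prodPoly (t.erase j) a c' = (C (a i) * X + C (c' i)) * R := by
    rw [← hR']
    conv_lhs => rw [← insert_erase hit', prodPoly_insert hit'']
  have hcard : t.card - 1 = ((t.erase j).card - 1) + 1 := by
    rw [card_erase_of_mem hj]
    have : 2 ≤ t.card := by
      have h1 : (t.erase j).card ≥ 1 := card_pos.2 ⟨i, hit'⟩
      rw [card_erase_of_mem hj] at h1; omega
    omega
  unfold DomG at hdom ⊢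
  rw [e1, hcard, pow_succ]
  rw [e2] at hdom
  have hlin : CoefNonneg (C (s + (1 - s) * b) * X + C ((1 - s) * b + s * β)) :=
    coefNonneg_lin (add_nonneg hs0 (mul_nonneg hs' hb)) (add_nonneg (mul_nonneg hs' hb) (mul_nonneg hs0 hβ))
  have step1 : CoefDom ((C (a j) * X + C (c j)) * ((C (a i) * X + C (c i)) * R) * E)
      (((C (s + (1 - s) * b) * X + C ((1 - s) * b + s * β)) * (C (a i) * X + C (c' i))) * R * E) := by
    have := (hstep.mul_right hR).mul_right hE
    refine (this.of_eq_left ?_)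
    ring
  have step2 := hdom.mul_left hlin
  refine (step1.trans (step2.of_eq_left ?_)).of_eq_right ?_
  · ring
  · ring

/-! ## The merged block budget -/

/-- The tightened block budget passes to a merged family: if `a₀·c'_i = c_i·c_j` and `c' = c` elsewhere on `t ∖ {j}`, then
`(∏_{t∖j} c')·x·a₀ = (∏_t c)·x`, so `(∏_t c)·x ≤ a₀^|t|` gives `(∏_{t∖j} c')·x ≤ a₀^|t∖j|` (`a₀ > 0`). [this work] -/
theorem block_of_merge [DecidableEq ι] {a₀ x : ℝ} (ha₀ : 0 < a₀) {t : Finset ι} {c c' : ι → ℝ} {i j : ι} (hij : i ≠ j)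
    (hi : i ∈ t) (hj : j ∈ t) (hc' : ∀ k ∈ t, k ≠ i → c' k = c k) (hmerge : a₀ * c' i = c i * c j)
    (hbud : (∏ k ∈ t, c k) * x ≤ a₀ ^ t.card) : (∏ k ∈ t.erase j, c' k) * x ≤ a₀ ^ (t.erase j).card := by
  have hit' : i ∈ t.erase j := mem_erase.2 ⟨hij, hi⟩
  have hsplit : ∏ k ∈ t.erase j, c' k = c' i * ∏ k ∈ (t.erase j).erase i, c k := by
    rw [← mul_prod_erase (t.erase j) _ hit']
    congr 1
    exact prod_congr rfl fun k hk => hc' k (mem_of_mem_erase (mem_of_mem_erase hk)) (mem_erase.1 hk).1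
  have hsplit2 : ∏ k ∈ t, c k = c j * (c i * ∏ k ∈ (t.erase j).erase i, c k) := by
    rw [mul_prod_erase (t.erase j) c hit', mul_prod_erase t c hj]
  have hcard : t.card = (t.erase j).card + 1 := by rw [card_erase_of_mem hj]; have := card_pos.2 ⟨j, hj⟩; omega
  have h1 : a₀ * ((∏ k ∈ t.erase j, c' k) * x) ≤ a₀ * a₀ ^ (t.erase j).card := by
    calc a₀ * ((∏ k ∈ t.erase j, c' k) * x) = (a₀ * c' i) * (∏ k ∈ (t.erase j).erase i, c k) * x := by
          rw [hsplit]; ring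
      _ = (∏ k ∈ t, c k) * x := by rw [hmerge, hsplit2]; ring
      _ ≤ a₀ ^ t.card := hbud
      _ = a₀ * a₀ ^ (t.erase j).card := by rw [hcard, pow_succ]; ring
  exact le_of_mul_le_mul_left h1 ha₀

/-! ## Merging two h-petals -/

/-- **The two-h merge keeps graded admissibility.**  Two h-petals `i ≠ j` (`u_j = b`, `m_i = m_j = b`) of an `AdmissibleG` family,
`0 < s ≤ 1`, `0 < b ≤ β`, `a₀ ≤ x`; `v'` with `a₀((1−s)b + s·v') = g_ig_j`.  Then the family on `t.erase j` with `vv_i := v'` is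
`AdmissibleG` with the same phantom. [this work] -/
theorem admissibleG_merge_h [DecidableEq ι] {s b β x : ℝ} (hb : 0 < b) (hbβ : b ≤ β) (hs0 : 0 < s) (hs1 : s ≤ 1)
    (hax : (1 - s) * b + s * β ≤ x) {t : Finset ι} {u vv m : ι → ℝ} (hadm : AdmissibleG s b β x t u vv m) {i j : ι}
    (hij : i ≠ j) (hi : i ∈ t) (hj : j ∈ t) (hmi : m i = b) (huj : u j = b) (hmj : m j = b) {v' : ℝ}
    (hv' : ((1 - s) * b + s * β) * ((1 - s) * b + s * v') = ((1 - s) * b + s * vv i) * ((1 - s) * b + s * vv j)) :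
    AdmissibleG s b β x (t.erase j) u (Function.update vv i v') m := by
  have h1 : AdmissibleOn s b β 1 t u vv m := hadm.toOn hs0.le hs1 hb hbβ hax
  have h2 : AdmissibleOn s b β 1 (t.erase j) u (Function.update vv i v') m :=
    admissibleOn_merge_h hb hbβ hs0 hs1 h1 hij hi hj hmi huj hmj hv'
  obtain ⟨hub', hu1', hvβ', hv1', hmb', hmu', hmv', hpu', hpv', -⟩ := h2
  obtain ⟨-, -, -, -, -, -, -, -, -, hpg⟩ := hadm
  have hs' : 0 ≤ 1 - s := sub_nonneg.2 hs1
  have ha₀ : 0 < (1 - s) * b + s * β := by nlinarith [hb.trans_le hbβ]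
  refine ⟨hub', hu1', hvβ', hv1', hmb', hmu', hmv', hpu', by rw [mul_one] at hpv'; exact hpv', ?_⟩
  refine block_of_merge (c := fun k => (1 - s) * m k + s * vv k) ha₀ hij hi hj (fun k _ hki => ?_) ?_ hpg
  · show (1 - s) * m k + s * Function.update vv i v' k = (1 - s) * m k + s * vv k
    rw [Function.update_of_ne hki]
  · show ((1 - s) * b + s * β) * ((1 - s) * m i + s * Function.update vv i v' i) =
      ((1 - s) * m i + s * vv i) * ((1 - s) * m j + s * vv j)
    rw [Function.update_self, hmi, hmj]; exact hv'

/-- **Merging two h-petals (graded).**  With the data of `admissibleG_merge_h` (and `u_i = b`): `DomG` for the merged family on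
`t.erase j` implies `DomG` for the original family on `t`. [this work] -/
theorem domG_of_merge_h [DecidableEq ι] {s b β x : ℝ} (hb : 0 < b) (hbβ : b ≤ β) (hs0 : 0 < s) (hs1 : s ≤ 1)
    (hax : (1 - s) * b + s * β ≤ x) {t : Finset ι} {u vv m : ι → ℝ} (hadm : AdmissibleG s b β x t u vv m) {i j : ι}
    (hij : i ≠ j) (hi : i ∈ t) (hj : j ∈ t) (hui : u i = b) (hmi : m i = b) (huj : u j = b) (hmj : m j = b) {v' : ℝ}
    (hv' : ((1 - s) * b + s * β) * ((1 - s) * b + s * v') = ((1 - s) * b + s * vv i) * ((1 - s) * b + s * vv j))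
    (hdom : DomG s b β x (t.erase j) u (Function.update vv i v') m) : DomG s b β x t u vv m := by
  obtain ⟨hub, _, hvβ, _, hmb, _, _, _, _, _⟩ := id hadm
  have hs' : 0 ≤ 1 - s := sub_nonneg.2 hs1
  have hβ : 0 < β := hb.trans_le hbβ
  have ha₀ : 0 < (1 - s) * b + s * β := by nlinarith
  refine domG_of_merge_pair hs0.le hs1 hb.le hβ.le (ha₀.le.trans hax) hij hi hj (fun k hk => hb.le.trans (hub k hk))
    (fun k hk => hb.le.trans (hmb k hk)) (fun k hk => hβ.le.trans (hvβ k hk))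
    (fun k _ hki => Function.update_of_ne hki v' vv) ?_ hdom
  rw [Function.update_self, hui, huj, hmi, hmj]
  refine coefDom_merge_h (by nlinarith) ha₀ (by nlinarith [hvβ j hj]) (by nlinarith [hvβ i hi]) ?_
  linarith [hv']

/-! ## Merging an h-petal into a leveraged tight petal -/

/-- **The h-into-T merge keeps graded admissibility.**  h-petal `i` (`u_i = m_i = b`), tight petal `r ≠ i` (`β m_r ≤ b vv_r`) of an
`AdmissibleG` family, `0 < s ≤ 1`, `0 < b ≤ β`, `a₀ ≤ x`; `v'` with `a₀((1−s)m_r + s v') = g_r g_i`.  Then the family on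
`t.erase i` with `vv_r := v'` is `AdmissibleG` with the same phantom. [this work] -/
theorem admissibleG_merge_hT [DecidableEq ι] {s b β x : ℝ} (hb : 0 < b) (hbβ : b ≤ β) (hs0 : 0 < s) (hs1 : s ≤ 1)
    (hax : (1 - s) * b + s * β ≤ x) {t : Finset ι} {u vv m : ι → ℝ} (hadm : AdmissibleG s b β x t u vv m) {i r : ι}
    (hri : r ≠ i) (hi : i ∈ t) (hr : r ∈ t) (hui : u i = b) (hmi : m i = b) (hlev : β * m r ≤ b * vv r) {v' : ℝ}
    (hv' : ((1 - s) * b + s * β) * ((1 - s) * m r + s * v') = ((1 - s) * m r + s * vv r) * ((1 - s) * b + s * vv i)) :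
    AdmissibleG s b β x (t.erase i) u (Function.update vv r v') m := by
  have h1 : AdmissibleOn s b β 1 t u vv m := hadm.toOn hs0.le hs1 hb hbβ hax
  have h2 : AdmissibleOn s b β 1 (t.erase i) u (Function.update vv r v') m :=
    admissibleOn_merge_hT hb hbβ hs0 hs1 h1 hri hi hr hui hmi hlev hv'
  obtain ⟨hub', hu1', hvβ', hv1', hmb', hmu', hmv', hpu', hpv', -⟩ := h2
  obtain ⟨-, -, -, -, -, -, -, -, -, hpg⟩ := hadm
  have hs' : 0 ≤ 1 - s := sub_nonneg.2 hs1
  have ha₀ : 0 < (1 - s) * b + s * β := by nlinarith [hb.trans_le hbβ]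
  refine ⟨hub', hu1', hvβ', hv1', hmb', hmu', hmv', hpu', by rw [mul_one] at hpv'; exact hpv', ?_⟩
  refine block_of_merge (c := fun k => (1 - s) * m k + s * vv k) ha₀ hri hr hi (fun k _ hkr => ?_) ?_ hpg
  · show (1 - s) * m k + s * Function.update vv r v' k = (1 - s) * m k + s * vv k
    rw [Function.update_of_ne hkr]
  · show ((1 - s) * b + s * β) * ((1 - s) * m r + s * Function.update vv r v' r) =
      ((1 - s) * m r + s * vv r) * ((1 - s) * m i + s * vv i)
    rw [Function.update_self, hmi]; exact hv'

/-- **Merging an h-petal into a leveraged tight petal (graded).**  With the data of `admissibleG_merge_hT` (and `m_r = u_r`,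
`β ≤ 1`): `DomG` for the merged family on `t.erase i` implies `DomG` for the original family on `t`. [this work] -/
theorem domG_of_merge_hT [DecidableEq ι] {s b β x : ℝ} (hb : 0 < b) (hbβ : b ≤ β) (hβ1 : β ≤ 1) (hs0 : 0 < s)
    (hs1 : s ≤ 1) (hax : (1 - s) * b + s * β ≤ x) {t : Finset ι} {u vv m : ι → ℝ}
    (hadm : AdmissibleG s b β x t u vv m) {i r : ι} (hri : r ≠ i) (hi : i ∈ t) (hr : r ∈ t) (hui : u i = b)
    (hmi : m i = b) (hmr : m r = u r) {v' : ℝ}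
    (hv' : ((1 - s) * b + s * β) * ((1 - s) * m r + s * v') = ((1 - s) * m r + s * vv r) * ((1 - s) * b + s * vv i))
    (hdom : DomG s b β x (t.erase i) u (Function.update vv r v') m) : DomG s b β x t u vv m := by
  obtain ⟨hub, _, hvβ, _, hmb, _, _, _, _, _⟩ := id hadm
  have hs' : 0 ≤ 1 - s := sub_nonneg.2 hs1
  have hβ : 0 < β := hb.trans_le hbβ
  have ha₀ : 0 < (1 - s) * b + s * β := by nlinarith
  refine domG_of_merge_pair hs0.le hs1 hb.le hβ.le (ha₀.le.trans hax) hri hr hi (fun k hk => hb.le.trans (hub k hk))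
    (fun k hk => hb.le.trans (hmb k hk)) (fun k hk => hβ.le.trans (hvβ k hk))
    (fun k _ hkr => Function.update_of_ne hkr v' vv) ?_ hdom
  rw [Function.update_self, hui, hmi]
  refine coefDom_merge_hT ha₀ (by nlinarith [hvβ i hi])
    (gammaHeavy_of_tight hs0.le hs1 hb.le hβ1 (hub r hr) (hvβ r hr) hmr) ?_
  linarith [hv']

end LinkedCurrency

end SafeCalc

end Summit.CriticalPhenomena.PercolationContinuityZ3.Theorems.SunflowerPartition
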